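import Literature.MathematicalPhysics.QuantumFieldTheory.Federbush1986.GaugeFixedCompetitor
import Literature.MathematicalPhysics.QuantumFieldTheory.Federbush1986.FieldMollification
import Literature.MathematicalPhysics.QuantumFieldTheory.Federbush1986.LandauModeMultiplierDecay

/-!
# `Federbush1986.ConstrainedMinimality` — [Federbush1986PhaseCellI] §3 (3.4) p. 327 «we construct a potential, A^N_μ(x), …
# minimizing the continuum action subject to this constraint»: THE EXPLICIT LANDAU-GAUGE MODE `A^N = CorrectedMode.field s` MINIMISES THE
# CONTINUUM ACTION AMONG ALL `C¹` POTENTIALS WITH THE SAME LEVEL-0 PLAQUETTE VARIABLES — PROVED; hence THE STATEMENT OF §0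
# (Estimates 0.1–0.7, `≤` reading) `axialTreeAveraging.ModeEstimatesLe` HOLDS UNCONDITIONALLY (`modeEstimatesLe`)

statement-level skeleton of published theorems with citation tags; proofs where landed; nothing here is a claim about the Yang–Mills mass gap

CITATION HEADER.  P. Federbush, *A phase cell approach to Yang–Mills theory. I. Modes, lattice-continuum duality*, Commun.
Math. Phys. **107** (1986) 319–329 [Federbush1986PhaseCellI]: §0 pp. 320–321 verbatim *«We will find an A_μ(x) compatible
with this assignment, minimizing the continuum action, and "smooth" enough, so that the following results hold for the
induced assignments to the finer lattices, and for A_μ(x)»* (Estimates 0.1–0.7), §3 p. 327 verbatim *«We also require A_μ(x) to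
minimize the continuum action, subject to the constraint of having the bond assignments at level r fixed.»*, *«In this section (and
Part II of this paper) we construct a potential, A^N_μ(x), satisfying Estimates 0.1–0.3, yielding the correct plaquette assignments at
level 0, and minimizing the continuum action subject to this constraint.»*, *«We seek a minimum of the action S, for a Landau gauge A′,
a gauge transformation of A. … (Alternatively one could use Lagrange multipliers.)»*, (3.4) p. 327, (3.11), (3.13)–(3.14) p. 328,
§4 p. 329.
The tree's `CorrectedMode.modeEstimatesLe_of_field_minimal` (p04/r17) reduced the §0 statement for the concrete Bałaban
averaging `axialTreeAveraging` to ONE hypothesis `hmin`: every `C¹` field with the level-0 plaquette variables of `field s`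
has at least its continuum action.  This module proves `hmin` (`field_minimal`) and concludes (`modeEstimatesLe`).  Unit
`lit-balaban-r17` gen 12; SKELETON rows F1.Eq3.1 (head), F1.Sect§0, F1.Eq3.2-3.12 of
`run/shared/lean/pub/lit-balaban/lit-balaban-r17/SKELETON-r17.md`.

THE MATHEMATICS (print: «Lagrange multipliers»; the tree's route).  Let `A = field s`, `A′ ∈ C¹` with the same level-0
plaquette variables, WLOG `S(A′) < ∞`; `ψ = A′ − A ∈ C¹` has finite action and zero plaquette variables, and
`S(A′) = S(A) + 2∫Σ_{μ<ν}F_{μν}(A)F_{μν}(ψ) + S(ψ)` (`ModeLinearity.toReal_contAction_add`), so it suffices that the CROSS TERM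
VANISHES (**`integral_crossDensity_field_eq_zero_of_plaq_eq_zero`**).  For smooth compactly supported test fields the tree has the
Euler–Lagrange identity with exponentially decaying bond multipliers `∫ΣF(A)F(Φ) = Σ_e μ_e Φ(e)` (`LandauModeBondMultipliers`,
`LandauModeMultiplierDecay`).  Gauge-fix `ψ` to `ψ̂_L = ψ − d(K₀ψ + λ_L)` (`GaugeFixedCompetitor`: continuous, field strength
`F(ψ)` in the sense that `F(ρ⋆ψ̂_L) = ρ⋆F(ψ)` for mollifiers `ρ` — `FieldMollification` —, ALL level-0 bond variables zero on
the lattice box of size `L`, `L¹` norm on `B_{4R+10}` polynomial in `R` for `L = 2R+6`).  (§1–§2) Cut off with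
`θ_R(x) = θ₁(x/R)` (`θ₁` a fixed bump, `= 1` on `B_R`, `= 0` off `B_{2R}`, `|dθ_R| ≤ B₁`): `F(θ_R f) = θ_R F(f) + dθ_R ∧ f`
(`fieldStrength_cut`); far bonds do not see `θ_R f`, near bonds see `f` (`approxTop_cut_eq_zero_of_far`, `approxTop_cut_eq_of_near`).
(§3) Apply the identity to `Φ_n = θ_R(ρ_n ⋆ ψ̂_L)` and let the mollifier radius → 0 (uniform convergence on `B_{4R+10}` of
`ρ_n⋆F(ψ)` and `ρ_n⋆ψ̂_L`, both sides converge; `eq_of_forall_dist_le`): **`integral_cut_eq_rhsSum`**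
`∫(θ_R Σ_{μ<ν}F(A)F(ψ) + Σ_{μ<ν}F(A)(∂_μθ_R ψ̂_ν − ∂_νθ_R ψ̂_μ)) = Σ_ν Σ_{m∈S′} μ_{(m,ν)} (θ_R ψ̂_L)(m, ν)`.  (§4) Let
`R → ∞` (`R = n+1`, `L = 2R+6`, `S′ = boxSet (2R+2)`): the inner bonds (`‖m‖ + 4 ≤ R`) have `(θ_Rψ̂_L)(m,ν) = ψ̂_L(m,ν) = 0`; the
others carry `|μ| ≤ C_μe^{−γ_μ(R−4)}` against `‖ψ̂_L‖_{L¹(B_{4R+10})} ≤ C(R+10)^{10}` (`abs_rhsSum_le`); the shell term is supported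
in `R ≤ ‖x‖ ≤ 2R` where `|F(A)| ≤ C_Ae^{−γ_AR}` ((3.14), `abs_integral_shellTerm_le`); and `∫θ_RΣF(A)F(ψ) → ∫ΣF(A)F(ψ)` by
dominated convergence.  Polynomial × exponential → 0 (`tendsto_pow_mul_exp_neg`), so the cross term is `0` by uniqueness of
limits.  (§5) **`field_minimal`** (= `hmin`) and **`modeEstimatesLe : axialTreeAveraging.ModeEstimatesLe`**.

v1.1 (r17 gen 13; DOCFIX of referee asks ref-1 gen 60 / ref-5 gen 46 addendum; declarations untouched): the v1 header (here and in the
docstring of `field_minimal`) quoted as p. 327 the sentences «Equation (3.1) is realized inductively proceeding upwards in r, the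
conditions imposed with Lagrange multipliers. It is easy to show there is a unique solution minimizing the continuum action subject to
this constraint[, e^{ipx}, if one works in the gauge (3.1)]» — they are on NO page of [Federbush1986PhaseCellI] (pp. 319–329 read;
referees ref-1 g60, ref-5 g46); they were a paraphrase and are replaced by the sentences actually printed on p. 327 (render
`lit-balaban-r17/renders/fedI/fed1986-cmp107-p009-x2.png`).  Print asserts minimality as a REQUIREMENT on the mode and constructs the
minimiser in §3/Part II; uniqueness is not claimed in print beyond §2's «at most one continuously differentiable A_μ(x)» (p. 326) and
§0's «[This does not determine A_μ(x) uniquely.]» (p. 320); this module proves the minimality (`field_minimal`), not a uniqueness.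
v1.2 (r17 gen 14; DOCFIX of referee ask ref-1 gen 65 (4); declarations untouched): the two `[cite:]` parentheticals of
`integral_cut_eq_rhsSum` and `integral_crossDensity_field_eq_zero_of_plaq_eq_zero` still carried the removed paraphrase («the conditions
imposed with Lagrange multipliers»); they now quote p. 327 verbatim («(Alternatively one could use Lagrange multipliers.)», «We also
require A_μ(x) to minimize the continuum action, subject to the constraint»).

WHAT THIS MODULE PROVIDES.  Defs with bodies `theta1`, `cutoff`, `dcut`, `cut`, `shellTerm`, `bulkTerm`, `rhsSum`; the theorems
above.  No `Prop` fact, no `sorry`; axioms standard.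
-/

namespace Literature.MathematicalPhysics.QuantumFieldTheory.Federbush1986

open Filter Set MeasureTheory Metric
open scoped Topology BigOperators ContDiff

noncomputable section

namespace CorrectedMode

open RadialGauge Mollify ModeLinearity LatticePotential

/-! ## §1 The smooth radial cut-off `θ_R(x) = θ₁(x/R)` -/

/-- The model bump: `1` on the unit ball, `0` outside the ball of radius `2`. [cite: Federbush1986PhaseCellI, §3 p. 327, (3.13) p. 328] -/
def theta1 : ContDiffBump (0 : E4) := ⟨1, 2, one_pos, one_lt_two⟩

/-- The cut-off at scale `R`: `θ_R(x) = θ₁(x/R)`. [cite: Federbush1986PhaseCellI, §3 p. 327 («minimizing the continuum action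
subject to this constraint»), (3.13) p. 328] -/
def cutoff (R : ℝ) (x : E4) : ℝ := (theta1 : E4 → ℝ) (R⁻¹ • x)

variable {R : ℝ}

/-- `θ_R` is smooth. [cite: Federbush1986PhaseCellI, §3 p. 327, (3.13) p. 328] -/
theorem contDiff_cutoff (R : ℝ) {n : ℕ∞} : ContDiff ℝ n (cutoff R) :=
  theta1.contDiff.comp (contDiff_id.const_smul R⁻¹)

/-- `0 ≤ θ_R ≤ 1`. [cite: Federbush1986PhaseCellI, §3 p. 327, (3.13) p. 328] -/
theorem cutoff_nonneg (R : ℝ) (x : E4) : 0 ≤ cutoff R x := theta1.nonneg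

/-- `θ_R ≤ 1`. [cite: Federbush1986PhaseCellI, §3 p. 327, (3.13) p. 328] -/
theorem cutoff_le_one (R : ℝ) (x : E4) : cutoff R x ≤ 1 := theta1.le_one

/-- `|θ_R| ≤ 1`. [cite: Federbush1986PhaseCellI, §3 p. 327, (3.13) p. 328] -/
theorem abs_cutoff_le_one (R : ℝ) (x : E4) : |cutoff R x| ≤ 1 := by
  rw [abs_of_nonneg (cutoff_nonneg R x)]; exact cutoff_le_one R x

/-- `θ_R = 1` on `B_R`. [cite: Federbush1986PhaseCellI, §3 p. 327, (3.13) p. 328] -/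
theorem cutoff_eq_one (hR : 0 < R) {x : E4} (hx : ‖x‖ ≤ R) : cutoff R x = 1 := by
  refine theta1.one_of_mem_closedBall ?_
  rw [mem_closedBall, dist_zero_right, norm_smul, Real.norm_of_nonneg (inv_nonneg.2 hR.le)]
  show R⁻¹ * ‖x‖ ≤ 1
  rw [inv_mul_le_iff₀ hR]; simpa using hx

/-- `θ_R = 0` off `B_{2R}`. [cite: Federbush1986PhaseCellI, §3 p. 327, (3.13) p. 328] -/
theorem cutoff_eq_zero (hR : 0 < R) {x : E4} (hx : 2 * R ≤ ‖x‖) : cutoff R x = 0 := by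
  refine theta1.zero_of_le_dist ?_
  rw [dist_zero_right, norm_smul, Real.norm_of_nonneg (inv_nonneg.2 hR.le)]
  show (2 : ℝ) ≤ R⁻¹ * ‖x‖
  rw [le_inv_mul_iff₀ hR]; linarith

/-- `dθ_R = 0` off `B_{2R}` (a minimum of `θ_R ≥ 0`). [cite: Federbush1986PhaseCellI, §3 p. 327, (3.13) p. 328] -/
theorem fderiv_cutoff_eq_zero (hR : 0 < R) {x : E4} (hx : 2 * R ≤ ‖x‖) : fderiv ℝ (cutoff R) x = 0 := by
  refine IsLocalMin.fderiv_eq_zero ?_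
  exact Eventually.of_forall fun y => by rw [cutoff_eq_zero hR hx]; exact cutoff_nonneg R y

/-- `θ_R` has compact support. [cite: Federbush1986PhaseCellI, §3 p. 327, (3.13) p. 328] -/
theorem hasCompactSupport_cutoff (hR : 0 < R) : HasCompactSupport (cutoff R) :=
  HasCompactSupport.intro (isCompact_closedBall (0 : E4) (2 * R)) fun x hx =>
    cutoff_eq_zero hR (le_of_lt (by simpa [dist_zero_right] using hx))

/-- A uniform bound for `dθ₁`. [cite: Federbush1986PhaseCellI, §3 p. 327, (3.13) p. 328] -/
theorem exists_fderiv_theta1_bound : ∃ B₁ : ℝ, 0 ≤ B₁ ∧ ∀ y : E4, ‖fderiv ℝ (theta1 : E4 → ℝ) y‖ ≤ B₁ := by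
  obtain ⟨C, hC⟩ := (theta1.hasCompactSupport.fderiv ℝ).exists_bound_of_continuous
    (theta1.contDiff (n := 1) |>.continuous_fderiv one_ne_zero)
  exact ⟨max C 0, le_max_right _ _, fun y => (hC y).trans (le_max_left _ _)⟩

/-- **`‖dθ_R‖ ≤ B₁` for `R ≥ 1`** (indeed `≤ B₁/R`). [cite: Federbush1986PhaseCellI, §3 p. 327, (3.13) p. 328] -/
theorem norm_fderiv_cutoff_le {B₁ : ℝ} (hB : ∀ y : E4, ‖fderiv ℝ (theta1 : E4 → ℝ) y‖ ≤ B₁) (hR : 1 ≤ R) (x : E4) :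
    ‖fderiv ℝ (cutoff R) x‖ ≤ B₁ := by
  have hR0 : 0 < R := one_pos.trans_le hR
  have hB0 : 0 ≤ B₁ := (norm_nonneg _).trans (hB 0)
  have hd : HasFDerivAt (cutoff R) ((fderiv ℝ (theta1 : E4 → ℝ) (R⁻¹ • x)).comp (R⁻¹ • ContinuousLinearMap.id ℝ E4)) x := by
    have h1 := (theta1.contDiff (n := 1)).differentiable one_ne_zero (R⁻¹ • x) |>.hasFDerivAt
    exact h1.comp x ((hasFDerivAt_id x).const_smul R⁻¹)
  rw [hd.fderiv]
  refine (ContinuousLinearMap.opNorm_comp_le _ _).trans ?_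
  rw [norm_smul, Real.norm_of_nonneg (inv_nonneg.2 hR0.le), ContinuousLinearMap.norm_id]
  calc ‖fderiv ℝ (theta1 : E4 → ℝ) (R⁻¹ • x)‖ * (R⁻¹ * 1) ≤ B₁ * (1 * 1) := by
        refine mul_le_mul (hB _) ?_ (by positivity) hB0
        exact mul_le_mul_of_nonneg_right (inv_le_one_of_one_le₀ hR) zero_le_one
    _ = B₁ := by ring

/-- The directional derivative `∂_μθ_R`. [cite: Federbush1986PhaseCellI, §3 p. 327, (3.13) p. 328] -/
def dcut (R : ℝ) (μ : Fin 4) (x : E4) : ℝ := fderiv ℝ (cutoff R) x (unitVec μ)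

/-- `|∂_μθ_R| ≤ B₁`. [cite: Federbush1986PhaseCellI, §3 p. 327, (3.13) p. 328] -/
theorem abs_dcut_le {B₁ : ℝ} (hB : ∀ y : E4, ‖fderiv ℝ (theta1 : E4 → ℝ) y‖ ≤ B₁) (hR : 1 ≤ R) (μ : Fin 4) (x : E4) :
    |dcut R μ x| ≤ B₁ := by
  unfold dcut
  rw [← Real.norm_eq_abs]
  refine (ContinuousLinearMap.le_opNorm _ _).trans ?_
  have hu : ‖(unitVec μ : E4)‖ = 1 := by simp [unitVec]
  rw [hu, mul_one]
  exact norm_fderiv_cutoff_le hB hR x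

/-- `∂_μθ_R = 0` off `B_{2R}`. [cite: Federbush1986PhaseCellI, §3 p. 327, (3.13) p. 328] -/
theorem dcut_eq_zero (hR : 0 < R) {x : E4} (hx : 2 * R ≤ ‖x‖) (μ : Fin 4) : dcut R μ x = 0 := by
  simp [dcut, fderiv_cutoff_eq_zero hR hx]

/-- `∂_μθ_R` is continuous. [cite: Federbush1986PhaseCellI, §3 p. 327, (3.13) p. 328] -/
theorem continuous_dcut (R : ℝ) (μ : Fin 4) : Continuous (dcut R μ) :=
  ((contDiff_cutoff R (n := 1)).continuous_fderiv one_ne_zero).clm_apply continuous_const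

/-! ## §2 Cut-off vector potentials -/

/-- The cut-off field `θ_R ψ`. [cite: Federbush1986PhaseCellI, §3 p. 327, (3.13) p. 328] -/
def cut (R : ℝ) (f : E4 → Fin 4 → ℝ) : E4 → Fin 4 → ℝ := fun x ν => cutoff R x * f x ν

/-- `θ_R f` is `C^n` for `C^n` `f`. [cite: Federbush1986PhaseCellI, §3 p. 327, (3.13) p. 328] -/
theorem contDiff_cut {f : E4 → Fin 4 → ℝ} {n : ℕ∞} (hf : ContDiff ℝ n f) : ContDiff ℝ n (cut R f) :=
  contDiff_pi.2 fun ν => (contDiff_cutoff R).mul (contDiff_pi.1 hf ν)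

/-- `θ_R f` is continuous for continuous `f`. [cite: Federbush1986PhaseCellI, §3 p. 327, (3.13) p. 328] -/
theorem continuous_cut {f : E4 → Fin 4 → ℝ} (hf : Continuous f) : Continuous (cut R f) :=
  continuous_pi fun ν => (contDiff_cutoff R (n := 0)).continuous.mul ((continuous_apply ν).comp hf)

/-- `θ_R f` has compact support. [cite: Federbush1986PhaseCellI, §3 p. 327, (3.13) p. 328] -/
theorem hasCompactSupport_cut (hR : 0 < R) (f : E4 → Fin 4 → ℝ) : HasCompactSupport (cut R f) :=
  HasCompactSupport.intro (isCompact_closedBall (0 : E4) (2 * R)) fun x hx => by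
    funext ν
    simp [cut, cutoff_eq_zero hR (le_of_lt (by simpa [dist_zero_right] using hx))]

/-- **Product rule**: `∂_μ(θ_R f)_ν = θ_R ∂_μf_ν + (∂_μθ_R) f_ν`. [cite: Federbush1986PhaseCellI, Estimate 0.2 (0.3) p. 320] -/
theorem pd_cut {f : E4 → Fin 4 → ℝ} (hf : ContDiff ℝ 1 f) (μ ν : Fin 4) (x : E4) :
    pd (cut R f) μ ν x = cutoff R x * pd f μ ν x + dcut R μ x * f x ν := by
  unfold pd cut dcut
  have hc : DifferentiableAt ℝ (cutoff R) x := (contDiff_cutoff R (n := 1)).differentiable one_ne_zero x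
  have hd : DifferentiableAt ℝ (fun y => f y ν) x := ((contDiff_pi.1 hf ν).differentiable one_ne_zero) x
  rw [fderiv_fun_mul hc hd]
  simp [mul_comm]

/-- **Field strength of the cut-off field**: `F_{μν}(θ_R f) = θ_R F_{μν}(f) + (∂_μθ_R f_ν − ∂_νθ_R f_μ)`.
[cite: Federbush1986PhaseCellI, §0 p. 319–320] -/
theorem fieldStrength_cut {f : E4 → Fin 4 → ℝ} (hf : ContDiff ℝ 1 f) (μ ν : Fin 4) (x : E4) :
    fieldStrength (cut R f) μ ν x
      = cutoff R x * fieldStrength f μ ν x + (dcut R μ x * f x ν - dcut R ν x * f x μ) := by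
  rw [fieldStrength, pd_cut hf, pd_cut hf, fieldStrength]; ring

/-- `‖u‖ ≤ 4` on the bond box `[0,1]³×[0,2]` (indeed `≤ √7`). [cite: Federbush1986PhaseCellI, §3 p. 327, (3.13) p. 328] -/
theorem norm_mkPt_le_four {μ : Fin 4} {u : Fin 4 → ℝ} (hu : u ∈ Icc (0 : Fin 4 → ℝ) (boxUp μ)) :
    ‖(mkPt u : E4)‖ ≤ 4 := by
  have hb : ∀ k, |(((0 : Fin 4 → ℤ) k : ℤ) : ℝ)| ≤ (0 : ℝ) := fun k => by simp
  have h := norm_src_add_mkPt_le (b := 0) (μ := μ) hb hu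
  have h0 : ((⟨0, μ⟩ : Edge 0).src : E4) = 0 := by
    ext k; simp [Edge.src, mkPt]
  rw [h0, zero_add] at h
  linarith

/-- **Far bonds do not see the cut-off field**: if some `|m_k| > 2R + 2` then `(θ_R f)(m, ν) = 0`.
[cite: Federbush1986PhaseCellI, (2.1)–(2.2) p. 325] -/
theorem approxTop_cut_eq_zero_of_far (hR : 0 < R) (f : E4 → Fin 4 → ℝ) {m : Fin 4 → ℤ} {ν : Fin 4}
    (hm : ∃ k, 2 * R + 2 < |(m k : ℝ)|) : approxTop 0 (cut R f) ⟨m, ν⟩ = 0 := by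
  obtain ⟨k, hk⟩ := hm
  unfold approxTop
  rw [setIntegral_eq_zero_of_forall_eq_zero fun u hu => ?_, mul_zero]
  have hx : 2 * R ≤ ‖(((⟨m, ν⟩ : Edge 0).src) + latLen 0 • mkPt u : E4)‖ := by
    rw [latLen_zero, one_smul]
    set x : E4 := ((⟨m, ν⟩ : Edge 0).src) + mkPt u with hxdef
    have h1 : |x k| ≤ ‖x‖ := by have := PiLp.norm_apply_le x k; rwa [Real.norm_eq_abs] at this
    have h2 : x k = (m k : ℝ) + u k := src_add_mkPt_apply m ν u k
    rw [h2] at h1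
    have h0 : 0 ≤ u k := hu.1 k
    have hu2 : u k ≤ 2 := by have := hu.2 k; dsimp only at this; split_ifs at this <;> linarith
    refine le_trans ?_ h1
    rcases le_or_gt 0 (m k : ℝ) with hmk | hmk
    · rw [abs_of_nonneg hmk] at hk; rw [abs_of_nonneg (by linarith)]; linarith
    · rw [abs_of_neg hmk] at hk; rw [abs_of_neg (by linarith)]; linarith
  show tent (u _) * cut R f _ _ = 0
  rw [cut, cutoff_eq_zero hR hx]; ring

/-- **Near bonds do not see the cut-off**: if the bond box lies in `B_R` then `(θ_R f)(m, ν) = f(m, ν)`.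
[cite: Federbush1986PhaseCellI, (2.1)–(2.2) p. 325] -/
theorem approxTop_cut_eq_of_near (hR : 0 < R) (f : E4 → Fin 4 → ℝ) {m : Fin 4 → ℤ} {ν : Fin 4}
    (hm : ∀ u ∈ Icc (0 : Fin 4 → ℝ) (boxUp ν), ‖(((⟨m, ν⟩ : Edge 0).src) + mkPt u : E4)‖ ≤ R) :
    approxTop 0 (cut R f) ⟨m, ν⟩ = approxTop 0 f ⟨m, ν⟩ := by
  unfold approxTop
  congr 1
  refine setIntegral_congr_fun measurableSet_Icc fun u hu => ?_
  show tent (u _) * cut R f _ _ = tent (u _) * f _ _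
  rw [cut, latLen_zero, one_smul, cutoff_eq_one hR (hm u hu), one_mul]

/-- **Cut-off bond variables in `L¹`**: `|(θ_R f)(m, ν)| ≤ ∫_{B_ρ}|f_ν|` when the bond box lies in `B_ρ`.
[cite: Federbush1986PhaseCellI, (2.1)–(2.2), (2.5) p. 325] -/
theorem abs_approxTop_cut_le_setIntegral {f : E4 → Fin 4 → ℝ} (hf : Continuous f) (m : Fin 4 → ℤ) (ν : Fin 4) {ρ : ℝ}
    (hρ : ∀ u ∈ Icc (0 : Fin 4 → ℝ) (boxUp ν), ‖(((⟨m, ν⟩ : Edge 0).src) + mkPt u : E4)‖ ≤ ρ) :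
    |approxTop 0 (cut R f) ⟨m, ν⟩| ≤ ∫ x in closedBall (0 : E4) ρ, |f x ν| := by
  refine (abs_approxTop_le_setIntegral (continuous_cut hf) m ν hρ).trans ?_
  have hK : IsCompact (closedBall (0 : E4) ρ) := isCompact_closedBall _ _
  have hfν : Continuous fun x => f x ν := (continuous_apply ν).comp hf
  refine setIntegral_mono_on (((continuous_apply ν).comp (continuous_cut (R := R) hf)).abs.continuousOn.integrableOn_compact hK)
    (hfν.abs.continuousOn.integrableOn_compact hK) measurableSet_closedBall fun x _ => ?_
  show |cutoff R x * f x ν| ≤ |f x ν|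
  rw [abs_mul]
  exact mul_le_of_le_one_left (abs_nonneg _) (abs_cutoff_le_one R x)

/-- **Local sup bound for bond variables**: `|A(b, μ)| ≤ M` if `|A_μ| ≤ M` on the bond box (tent weight has unit mass).
[cite: Federbush1986PhaseCellI, (2.5) p. 325] -/
theorem abs_approxTop_le_of_box {A : E4 → Fin 4 → ℝ} (hA : Continuous A) (b : Fin 4 → ℤ) (μ : Fin 4) {M : ℝ}
    (hM : ∀ u ∈ Icc (0 : Fin 4 → ℝ) (boxUp μ), |A ((((⟨b, μ⟩ : Edge 0).src) + mkPt u : E4)) μ| ≤ M) :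
    |approxTop 0 A ⟨b, μ⟩| ≤ M := by
  set f : (Fin 4 → ℝ) → ℝ := fun u => tent (u μ) * A (((⟨b, μ⟩ : Edge 0).src) + mkPt u) μ with hf
  have hmk : Continuous (fun u : Fin 4 → ℝ => (mkPt u : E4)) := PiLp.continuous_toLp 2 _
  have hg : Continuous fun u : Fin 4 → ℝ => A (((⟨b, μ⟩ : Edge 0).src) + mkPt u) μ :=
    ((continuous_apply μ).comp hA).comp (continuous_const.add hmk)
  have hK : IsCompact (Icc (0 : Fin 4 → ℝ) (boxUp μ)) := isCompact_Icc
  have happrox : approxTop 0 A ⟨b, μ⟩ = ∫ u in Icc (0 : Fin 4 → ℝ) (boxUp μ), f u := by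
    show latLen 0 * _ = _
    rw [latLen_zero, one_mul]
    refine setIntegral_congr_fun measurableSet_Icc fun u _ => ?_
    simp [hf]
  rw [happrox]
  calc |∫ u in Icc (0 : Fin 4 → ℝ) (boxUp μ), f u| ≤ ∫ u in Icc (0 : Fin 4 → ℝ) (boxUp μ), M * tent (u μ) := by
        refine abs_integral_le_integral_abs.trans (setIntegral_mono_on
          (((continuous_tent.comp (continuous_apply μ)).mul hg).continuousOn.integrableOn_compact hK).abs
          ((continuous_const.mul (continuous_tent.comp (continuous_apply μ))).continuousOn.integrableOn_compact hK)
          measurableSet_Icc fun u hu => ?_)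
        have h0 : 0 ≤ u μ := hu.1 μ
        have h2 : u μ ≤ 2 := by have := hu.2 μ; simpa [boxUp] using this
        rw [hf, abs_mul, abs_of_nonneg (tent_nonneg h0 h2), mul_comm]
        exact mul_le_mul_of_nonneg_right (hM u hu) (tent_nonneg h0 h2)
    _ = M := by rw [integral_const_mul, integral_box_tent, mul_one]

/-! ## §3 The Euler–Lagrange identity for the cut-off gauge-fixed competitor (limit over mollifiers) -/

variable {ψ : E4 → Fin 4 → ℝ}

/-- **A uniform exponential bound for the field strength of the mode** `|F_{μν}(A^N)(x)| ≤ C_A e^{−γ‖x‖}` ((3.14)).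
[cite: Federbush1986PhaseCellI, (3.14) p. 328] -/
theorem exists_fieldStrength_field_bound (s : ℕ) : ∃ CA γA : ℝ, 0 ≤ CA ∧ 0 < γA ∧
    ∀ μ ν x, |fieldStrength (field s) μ ν x| ≤ CA * Real.exp (-(γA * ‖x‖)) := by
  obtain ⟨c, hc, γ, hγ, cε, -, -, hpd, -⟩ := decay313to315_field s
  refine ⟨2 * c, γ, by positivity, hγ, fun μ ν x => ?_⟩
  have h1 := hpd x μ ν
  have h2 := hpd x ν μ
  rw [show -γ * ‖x‖ = -(γ * ‖x‖) by ring] at h1 h2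
  rw [fieldStrength]
  calc |pd (field s) μ ν x - pd (field s) ν μ x| ≤ |pd (field s) μ ν x| + |pd (field s) ν μ x| := abs_sub _ _
    _ ≤ 2 * c * Real.exp (-(γ * ‖x‖)) := by linarith

/-- The shell term `V(x) = Σ_{μ<ν} F_{μν}(A^N)(∂_μθ_R f_ν − ∂_νθ_R f_μ)`. [cite: Federbush1986PhaseCellI, §3 p. 327] -/
def shellTerm (s : ℕ) (R : ℝ) (f : E4 → Fin 4 → ℝ) (x : E4) : ℝ :=
  ∑ μ, ∑ ν, if μ < ν then fieldStrength (field s) μ ν x * (dcut R μ x * f x ν - dcut R ν x * f x μ) else 0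

/-- The bulk term `Σ_{μ<ν} F_{μν}(A^N)·G_{μν}` for a family `G`. [cite: Federbush1986PhaseCellI, §3 p. 327] -/
def bulkTerm (s : ℕ) (G : Fin 4 → Fin 4 → E4 → ℝ) (x : E4) : ℝ :=
  ∑ μ, ∑ ν, if μ < ν then fieldStrength (field s) μ ν x * G μ ν x else 0

/-- `bulkTerm` of `F(ψ)` is the polarised density. [cite: Federbush1986PhaseCellI, §0 p. 319–320] -/
theorem bulkTerm_fieldStrength (s : ℕ) (ψ : E4 → Fin 4 → ℝ) (x : E4) :
    bulkTerm s (fieldStrength ψ) x = crossDensity (field s) ψ x := rfl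

/-- The shell term vanishes off `B_{2R}`. [cite: Federbush1986PhaseCellI, §3 p. 327, (3.13) p. 328] -/
theorem shellTerm_eq_zero (hR : 0 < R) (s : ℕ) (f : E4 → Fin 4 → ℝ) {x : E4} (hx : 2 * R ≤ ‖x‖) :
    shellTerm s R f x = 0 := by
  unfold shellTerm
  simp [dcut_eq_zero hR hx]

/-- The shell term is continuous for continuous `f`. [cite: Federbush1986PhaseCellI, §3 p. 327, (3.13) p. 328] -/
theorem continuous_shellTerm (s : ℕ) (R : ℝ) {f : E4 → Fin 4 → ℝ} (hf : Continuous f) : Continuous (shellTerm s R f) := by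
  unfold shellTerm
  refine continuous_finsetSum _ fun μ _ => continuous_finsetSum _ fun ν _ => ?_
  split_ifs
  · exact (continuous_fieldStrength (contDiff_field s) μ ν).mul
      (((continuous_dcut R μ).mul ((continuous_apply ν).comp hf)).sub
        ((continuous_dcut R ν).mul ((continuous_apply μ).comp hf)))
  · exact continuous_const

/-- The shell term is integrable (continuous, compact support). [cite: Federbush1986PhaseCellI, §3 p. 327, (3.13) p. 328] -/
theorem integrable_shellTerm (hR : 0 < R) (s : ℕ) {f : E4 → Fin 4 → ℝ} (hf : Continuous f) :
    Integrable (shellTerm s R f) :=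
  (continuous_shellTerm s R hf).integrable_of_hasCompactSupport
    (HasCompactSupport.intro (isCompact_closedBall (0 : E4) (2 * R)) fun x hx =>
      shellTerm_eq_zero hR s f (le_of_lt (by simpa [dist_zero_right] using hx)))

/-- The cut bulk term `θ_R · crossDensity(A^N, ψ)` is integrable. [cite: Federbush1986PhaseCellI, §3 p. 327, (3.13) p. 328] -/
theorem integrable_cutoff_mul_crossDensity (s : ℕ) (hψ : ContDiff ℝ 1 ψ) (hfin : contAction ψ ≠ ⊤) (R : ℝ) :
    Integrable fun x => cutoff R x * crossDensity (field s) ψ x := by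
  refine (integrable_crossDensity (contDiff_field s) hψ (contAction_field_ne_top s) hfin).bdd_mul (c := 1)
    (contDiff_cutoff R (n := 0)).continuous.aestronglyMeasurable (Eventually.of_forall fun x => ?_)
  rw [Real.norm_eq_abs]; exact abs_cutoff_le_one R x

/-- **The mollified gauge-fixed competitor has field strength `ρ ⋆ F(ψ)`** (the two pure gauges are killed).
[cite: Federbush1986PhaseCellI, (3.2) p. 327, §0 p. 319] -/
theorem fieldStrength_mollV_psiHat (φ : ContDiffBump (0 : E4)) (hψ : ContDiff ℝ 1 ψ) (L : ℕ) (μ ν : Fin 4) (x : E4) :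
    fieldStrength (mollV φ (psiHat ψ L)) μ ν x = moll φ (fieldStrength ψ μ ν) x := by
  have hK := contDiff_scalarPot hψ
  have hG : ContDiff ℝ 1 (gaugeFn ψ L) := contDiff_gaugeFn ψ L
  have hc1 : Continuous ψ := hψ.continuous
  have hc2 : Continuous (pureGauge (scalarPot ψ)) := continuous_pureGauge hK
  have hc3 : Continuous (pureGauge (gaugeFn ψ L)) := continuous_pureGauge hG
  have heq : mollV φ (psiHat ψ L) = (mollV φ ψ - mollV φ (pureGauge (scalarPot ψ))) - mollV φ (pureGauge (gaugeFn ψ L)) := by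
    funext x ν
    simp only [mollV, Pi.sub_apply, psiHat, radial]
    have ha : Continuous fun y => ψ y ν := (continuous_apply ν).comp hc1
    have hb : Continuous fun y => pureGauge (scalarPot ψ) y ν := (continuous_apply ν).comp hc2
    have hc : Continuous fun y => pureGauge (gaugeFn ψ L) y ν := (continuous_apply ν).comp hc3
    rw [moll_sub (f := fun y => ψ y ν - pureGauge (scalarPot ψ) y ν) (g := fun y => pureGauge (gaugeFn ψ L) y ν)
      (ha.sub hb) hc, moll_sub (f := fun y => ψ y ν) (g := fun y => pureGauge (scalarPot ψ) y ν) ha hb]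
  have hm1 : ContDiff ℝ 1 (mollV φ ψ) := contDiff_mollV hc1
  have hm2 : ContDiff ℝ 1 (mollV φ (pureGauge (scalarPot ψ))) := contDiff_mollV hc2
  have hm3 : ContDiff ℝ 1 (mollV φ (pureGauge (gaugeFn ψ L))) := contDiff_mollV hc3
  rw [heq, fieldStrength_sub (A := mollV φ ψ - mollV φ (pureGauge (scalarPot ψ))) (B := mollV φ (pureGauge (gaugeFn ψ L)))
    (hm1.sub hm2) hm3, fieldStrength_sub (A := mollV φ ψ) (B := mollV φ (pureGauge (scalarPot ψ))) hm1 hm2,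
    fieldStrength_mollV hψ, fieldStrength_mollV_pureGauge hK, fieldStrength_mollV_pureGauge hG]
  ring

/-- **The polarised density against the cut mollified competitor**: `θ_R · Σ F_A (ρ⋆G) + shell term of ρ⋆ψ̂`.
[cite: Federbush1986PhaseCellI, §3 p. 327] -/
theorem crossDensity_cut_mollV (φ : ContDiffBump (0 : E4)) (s : ℕ) (hψ : ContDiff ℝ 1 ψ) (L : ℕ) (x : E4) :
    crossDensity (field s) (cut R (mollV φ (psiHat ψ L))) x
      = cutoff R x * bulkTerm s (fun μ ν y => moll φ (fieldStrength ψ μ ν) y) x + shellTerm s R (mollV φ (psiHat ψ L)) x := by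
  have hm : ContDiff ℝ 1 (mollV φ (psiHat ψ L)) := contDiff_mollV (continuous_psiHat hψ L)
  rw [crossDensity_def, bulkTerm, shellTerm, Finset.mul_sum, ← Finset.sum_add_distrib]
  refine Finset.sum_congr rfl fun μ _ => ?_
  rw [Finset.mul_sum, ← Finset.sum_add_distrib]
  refine Finset.sum_congr rfl fun ν _ => ?_
  split_ifs
  · rw [fieldStrength_cut hm, fieldStrength_mollV_psiHat φ hψ L]; ring
  · simp

/-- **Pointwise closeness of the integrands**: on the support of the cut-off, if `ρ ⋆ G` and `ρ ⋆ ψ̂` are `η`-close to `G`, `ψ̂`,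
the two integrands differ by `≤ 16 C_A (1 + 2B₁) η`. [cite: Federbush1986PhaseCellI, §3 p. 327] -/
theorem abs_integrand_sub_le {s : ℕ} {CA B₁ η : ℝ} (hCA : ∀ μ ν x, |fieldStrength (field s) μ ν x| ≤ CA)
    (hB : ∀ μ x, |dcut R μ x| ≤ B₁) {G G' : Fin 4 → Fin 4 → E4 → ℝ} {f f' : E4 → Fin 4 → ℝ} {x : E4}
    (hG : ∀ μ ν, |G' μ ν x - G μ ν x| ≤ η) (hf : ∀ ν, |f' x ν - f x ν| ≤ η) :
    |(cutoff R x * bulkTerm s G' x + shellTerm s R f' x) - (cutoff R x * bulkTerm s G x + shellTerm s R f x)|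
      ≤ 16 * CA * (1 + 2 * B₁) * η := by
  have hCA0 : 0 ≤ CA := (abs_nonneg _).trans (hCA 0 0 x)
  have hB0 : 0 ≤ B₁ := (abs_nonneg _).trans (hB 0 x)
  have hη0 : 0 ≤ η := (abs_nonneg _).trans (hf 0)
  -- write the difference as a double sum
  have hdiff : (cutoff R x * bulkTerm s G' x + shellTerm s R f' x) - (cutoff R x * bulkTerm s G x + shellTerm s R f x)
      = ∑ μ, ∑ ν, if μ < ν then fieldStrength (field s) μ ν x *
          (cutoff R x * (G' μ ν x - G μ ν x) + (dcut R μ x * (f' x ν - f x ν) - dcut R ν x * (f' x μ - f x μ))) else 0 := by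
    simp only [bulkTerm, shellTerm, Finset.mul_sum, ← Finset.sum_add_distrib, ← Finset.sum_sub_distrib]
    refine Finset.sum_congr rfl fun μ _ => Finset.sum_congr rfl fun ν _ => ?_
    split_ifs <;> ring
  rw [hdiff]
  have hterm : ∀ μ ν, |(if μ < ν then fieldStrength (field s) μ ν x *
      (cutoff R x * (G' μ ν x - G μ ν x) + (dcut R μ x * (f' x ν - f x ν) - dcut R ν x * (f' x μ - f x μ))) else 0)|
      ≤ CA * ((1 + 2 * B₁) * η) := by
    intro μ ν
    split_ifs
    · rw [abs_mul]
      refine mul_le_mul (hCA μ ν x) ?_ (abs_nonneg _) hCA0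
      calc |cutoff R x * (G' μ ν x - G μ ν x) + (dcut R μ x * (f' x ν - f x ν) - dcut R ν x * (f' x μ - f x μ))|
          ≤ |cutoff R x * (G' μ ν x - G μ ν x)| + (|dcut R μ x * (f' x ν - f x ν)| + |dcut R ν x * (f' x μ - f x μ)|) :=
            (abs_add_le _ _).trans (add_le_add le_rfl (abs_sub _ _))
        _ ≤ 1 * η + (B₁ * η + B₁ * η) := by
            rw [abs_mul, abs_mul, abs_mul]
            exact add_le_add (mul_le_mul (abs_cutoff_le_one R x) (hG μ ν) (abs_nonneg _) zero_le_one)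
              (add_le_add (mul_le_mul (hB μ x) (hf ν) (abs_nonneg _) hB0) (mul_le_mul (hB ν x) (hf μ) (abs_nonneg _) hB0))
        _ = (1 + 2 * B₁) * η := by ring
    · rw [abs_zero]; positivity
  calc |∑ μ, ∑ ν, (if μ < ν then fieldStrength (field s) μ ν x *
          (cutoff R x * (G' μ ν x - G μ ν x) + (dcut R μ x * (f' x ν - f x ν) - dcut R ν x * (f' x μ - f x μ))) else 0)|
      ≤ ∑ μ, ∑ ν, CA * ((1 + 2 * B₁) * η) := by
        refine (Finset.abs_sum_le_sum_abs _ _).trans (Finset.sum_le_sum fun μ _ => ?_)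
        exact (Finset.abs_sum_le_sum_abs _ _).trans (Finset.sum_le_sum fun ν _ => hterm μ ν)
    _ = 16 * CA * (1 + 2 * B₁) * η := by simp; ring

/-- `θ_R f − θ_R g = θ_R (f − g)` at the level of bond variables. [cite: Federbush1986PhaseCellI, §3 p. 327, (3.13) p. 328] -/
theorem approxTop_cut_sub {f g : E4 → Fin 4 → ℝ} (hf : Continuous f) (hg : Continuous g) (e : Edge 0) :
    approxTop 0 (cut R f) e - approxTop 0 (cut R g) e = approxTop 0 (cut R (fun x ν => f x ν - g x ν)) e := by
  have h1 : cut R (fun x ν => f x ν - g x ν) = fun x ν => cut R f x ν + ((-1 : ℝ) • cut R g) x ν := by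
    funext x ν; simp [cut]; ring
  rw [h1, approxTop_add (continuous_cut hf) ((continuous_cut hg).const_smul _), ModeLinearity.approxTop_smul]
  ring

/-- The right-hand side `Σ_ν Σ_{m∈S′} μ_{(m,ν)} (θ_R f)(m, ν)`. [cite: Federbush1986PhaseCellI, §3 p. 327 («Lagrange multipliers»)] -/
def rhsSum (R : ℝ) (f : E4 → Fin 4 → ℝ) (S' : Finset (Fin 4 → ℤ)) : ℝ :=
  ∑ ν, ∑ m ∈ S', bondMult ν m * approxTop 0 (cut R f) ⟨m, ν⟩

/-- Every bond box of a not-far bond lies in `B_{4R+10}`. [cite: Federbush1986PhaseCellI, §3 p. 327, (3.13) p. 328] -/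
theorem box_subset_of_not_far {m : Fin 4 → ℤ} (hm : ¬ ∃ k, 2 * R + 2 < |(m k : ℝ)|) (ν : Fin 4) :
    ∀ u ∈ Icc (0 : Fin 4 → ℝ) (boxUp ν), ‖(((⟨m, ν⟩ : Edge 0).src) + mkPt u : E4)‖ ≤ 4 * R + 10 := by
  push Not at hm
  intro u hu
  exact (norm_src_add_mkPt_le hm hu).trans (by linarith)

/-- **THE EULER–LAGRANGE IDENTITY FOR THE CUT-OFF GAUGE-FIXED COMPETITOR**: for `ψ ∈ C¹` of finite action, `R ≥ 1`, any `L`,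
and any finite `S′ ⊇ {m : |m_k| ≤ 2R+2 ∀k}`,
`∫ (θ_R·Σ_{μ<ν}F_A F_{μν}(ψ) + Σ_{μ<ν}F_A(∂_μθ_R ψ̂_ν − ∂_νθ_R ψ̂_μ)) = Σ_ν Σ_{m∈S′} μ_{(m,ν)} (θ_R ψ̂_L)(m, ν)` — the identity of
`LandauModeBondMultipliers` for the smooth compactly supported test fields `θ_R (ρ_n ⋆ ψ̂_L)`, in the limit of mollifiers
`ρ_n` (both sides converge: uniform convergence on compacts of `ρ_n ⋆ F(ψ)` and `ρ_n ⋆ ψ̂_L`).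
[cite: Federbush1986PhaseCellI, §3 p. 327 («(Alternatively one could use Lagrange multipliers.)»), (3.4) p. 327] -/
theorem integral_cut_eq_rhsSum (s : ℕ) (hψ : ContDiff ℝ 1 ψ) (hfin : contAction ψ ≠ ⊤) (hR : 1 ≤ R) (L : ℕ)
    (S' : Finset (Fin 4 → ℤ)) (hS' : ∀ m ∉ S', ∃ k, 2 * R + 2 < |(m k : ℝ)|) :
    ∫ x, (cutoff R x * crossDensity (field s) ψ x + shellTerm s R (psiHat ψ L) x) = rhsSum R (psiHat ψ L) S' := by
  have hR0 : 0 < R := one_pos.trans_le hR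
  obtain ⟨CA, γA, hCA0, hγA, hFA⟩ := exists_fieldStrength_field_bound s
  have hCA : ∀ μ ν x, |fieldStrength (field s) μ ν x| ≤ CA := fun μ ν x =>
    (hFA μ ν x).trans (mul_le_of_le_one_right hCA0 (Real.exp_le_one_iff.2 (by
      have := norm_nonneg x; nlinarith)))
  obtain ⟨B₁, hB₁0, hB₁⟩ := exists_fderiv_theta1_bound
  have hdc : ∀ μ x, |dcut R μ x| ≤ B₁ := fun μ x => abs_dcut_le hB₁ hR μ x
  obtain ⟨Cμ, γμ, hCμ0, hγμ, hμ⟩ := exists_bondMult_le_exp_sum_all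
  have hμ' : ∀ ν m, |bondMult ν m| ≤ Cμ := fun ν m =>
    (hμ ν m).trans (mul_le_of_le_one_right hCμ0 (Real.exp_le_one_iff.2 (by
      have : 0 ≤ ∑ k, |((m k : ℤ) : ℝ)| := Finset.sum_nonneg fun k _ => abs_nonneg _
      nlinarith)))
  set K₀ := closedBall (0 : E4) (2 * R) with hK₀
  set v₀ := (volume K₀).toReal with hv₀
  have hv₀0 : 0 ≤ v₀ := ENNReal.toReal_nonneg
  set cW : ℝ := 16 * CA * (1 + 2 * B₁) with hcW
  have hcW0 : 0 ≤ cW := by positivity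
  have hψc := continuous_psiHat hψ L
  have hGc : ∀ μ ν, Continuous (fieldStrength ψ μ ν) := continuous_fieldStrength hψ
  -- the limiting objects
  set Ψ := psiHat ψ L with hΨ
  refine eq_of_forall_dist_le fun ε hε => ?_
  -- tolerance
  set D : ℝ := v₀ * cW + 4 * S'.card * Cμ + 1 with hD
  have hD0 : 0 < D := by positivity
  set η : ℝ := ε / (2 * D) with hη
  have hη0 : 0 < η := by positivity
  -- mollifier radius from uniform continuity on `B_{4R+10}`
  have hK : IsCompact (closedBall (0 : E4) (4 * R + 10)) := isCompact_closedBall _ _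
  obtain ⟨δ₁, hδ₁, h₁⟩ := mollV_uniform hψc hK hη0
  have hGc' : ∀ μ, Continuous (fun x ν => fieldStrength ψ μ ν x) := fun μ => continuous_pi fun ν => hGc μ ν
  choose δ₂ hδ₂ h₂ using fun μ => mollV_uniform (hGc' μ) hK hη0
  set δ : ℝ := min δ₁ (Finset.univ.inf' Finset.univ_nonempty δ₂) with hδ
  have hδ0 : 0 < δ := lt_min hδ₁ ((Finset.lt_inf'_iff _).2 fun μ _ => hδ₂ μ)
  let φ : ContDiffBump (0 : E4) := ⟨δ / 2, δ, by positivity, by linarith⟩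
  have hφ1 : φ.rOut ≤ δ₁ := min_le_left _ _
  have hφ2 : ∀ μ, φ.rOut ≤ δ₂ μ := fun μ => (min_le_right _ _).trans (Finset.inf'_le _ (Finset.mem_univ μ))
  -- the smooth compactly supported test field and the identity of `LandauModeBondMultipliers`
  set Φ := cut R (mollV φ Ψ) with hΦ
  have hmc : Continuous (mollV φ Ψ) := (contDiff_mollV (n := 0) hψc).continuous
  have hΦs : ContDiff ℝ ∞ Φ := contDiff_cut (contDiff_mollV hψc)
  have hΦsupp : HasCompactSupport Φ := hasCompactSupport_cut hR0 _
  have hB := integral_crossDensity_field_eq_sum_bondMult s hΦs hΦsupp S'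
    (fun ν m hm => approxTop_cut_eq_zero_of_far hR0 _ (hS' m hm))
  -- (i) the left-hand sides are close
  have hW_int : Integrable fun x => cutoff R x * crossDensity (field s) ψ x + shellTerm s R Ψ x :=
    (integrable_cutoff_mul_crossDensity s hψ hfin R).add (integrable_shellTerm hR0 s hψc)
  have hΦ_int : Integrable (crossDensity (field s) Φ) :=
    integrable_crossDensity (contDiff_field s) (hΦs.of_le (by exact_mod_cast le_top)) (contAction_field_ne_top s)
      (contAction_test_ne_top hΦs hΦsupp)
  have hclose1 : |(∫ x, crossDensity (field s) Φ x) - ∫ x, (cutoff R x * crossDensity (field s) ψ x + shellTerm s R Ψ x)|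
      ≤ v₀ * cW * η := by
    rw [← integral_sub hΦ_int hW_int]
    have hg : Integrable (K₀.indicator fun _ : E4 => cW * η) :=
      (integrableOn_const ((isCompact_closedBall (0 : E4) (2 * R)).measure_lt_top.ne)).integrable_indicator
        measurableSet_closedBall
    refine (Real.norm_eq_abs _ ▸ norm_integral_le_of_norm_le hg (Eventually.of_forall fun x => ?_)).trans (le_of_eq ?_)
    · rw [Real.norm_eq_abs]
      by_cases hx : x ∈ K₀
      · rw [indicator_of_mem hx, crossDensity_cut_mollV φ s hψ L x, ← bulkTerm_fieldStrength]
        refine abs_integrand_sub_le hCA hdc (fun μ ν => ?_) (fun ν => ?_)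
        · have := h₂ μ φ (hφ2 μ) x (closedBall_subset_closedBall (by linarith) hx) ν
          simpa [mollV] using this
        · exact h₁ φ hφ1 x (closedBall_subset_closedBall (by linarith) hx) ν
      · rw [indicator_of_notMem hx]
        have hx' : 2 * R ≤ ‖x‖ := le_of_lt (by simpa [hK₀, dist_zero_right] using hx)
        rw [crossDensity_cut_mollV φ s hψ L x, shellTerm_eq_zero hR0, shellTerm_eq_zero hR0, cutoff_eq_zero hR0 hx']
        · simp
        · exact hx'
        · exact hx'
    · rw [integral_indicator_const _ measurableSet_closedBall, smul_eq_mul, hv₀, measureReal_def]; ring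
  -- (ii) the right-hand sides are close
  have hclose2 : |(∑ ν, ∑ m ∈ S', bondMult ν m * approxTop 0 Φ ⟨m, ν⟩) - rhsSum R Ψ S'| ≤ 4 * S'.card * Cμ * η := by
    rw [rhsSum, ← Finset.sum_sub_distrib]
    have hin : ∀ ν, ∀ m ∈ S', |bondMult ν m * approxTop 0 Φ ⟨m, ν⟩ - bondMult ν m * approxTop 0 (cut R Ψ) ⟨m, ν⟩| ≤ Cμ * η := by
      intro ν m _
      rw [← mul_sub, abs_mul, hΦ, approxTop_cut_sub hmc hψc]
      refine mul_le_mul (hμ' ν m) ?_ (abs_nonneg _) hCμ0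
      by_cases hfar : ∃ k, 2 * R + 2 < |(m k : ℝ)|
      · rw [approxTop_cut_eq_zero_of_far hR0 _ hfar, abs_zero]; exact hη0.le
      · refine abs_approxTop_le_of_box (continuous_cut (hmc.sub hψc |> fun h => by
          exact continuous_pi fun ν => ((continuous_apply ν).comp hmc).sub ((continuous_apply ν).comp hψc))) m ν
          fun u hu => ?_
        show |cutoff R _ * (mollV φ Ψ _ ν - Ψ _ ν)| ≤ η
        rw [abs_mul]
        refine (mul_le_mul (abs_cutoff_le_one R _) (h₁ φ hφ1 _ ?_ ν) (abs_nonneg _) zero_le_one).trans_eq (one_mul η)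
        exact mem_closedBall_zero_iff.2 (box_subset_of_not_far hfar ν u hu)
    calc |∑ ν, (∑ m ∈ S', bondMult ν m * approxTop 0 Φ ⟨m, ν⟩ - ∑ m ∈ S', bondMult ν m * approxTop 0 (cut R Ψ) ⟨m, ν⟩)|
        ≤ ∑ ν, ∑ m ∈ S', Cμ * η := by
          refine (Finset.abs_sum_le_sum_abs _ _).trans (Finset.sum_le_sum fun ν _ => ?_)
          rw [← Finset.sum_sub_distrib]
          exact (Finset.abs_sum_le_sum_abs _ _).trans (Finset.sum_le_sum fun m hm => hin ν m hm)
      _ = 4 * S'.card * Cμ * η := by simp; ring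
  -- conclusion
  rw [Real.dist_eq]
  have hkey : |(∫ x, (cutoff R x * crossDensity (field s) ψ x + shellTerm s R Ψ x)) - rhsSum R Ψ S'|
      ≤ v₀ * cW * η + 4 * S'.card * Cμ * η := by
    have := abs_sub_le (∫ x, (cutoff R x * crossDensity (field s) ψ x + shellTerm s R Ψ x))
      (∫ x, crossDensity (field s) Φ x) (rhsSum R Ψ S')
    rw [abs_sub_comm] at hclose1
    have e2 : |(∫ x, crossDensity (field s) Φ x) - rhsSum R Ψ S'| ≤ 4 * S'.card * Cμ * η := by rw [hB]; exact hclose2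
    linarith [this, hclose1, e2]
  refine hkey.trans ?_
  have : (v₀ * cW + 4 * S'.card * Cμ) * η ≤ ε / 2 := by
    rw [hη]
    rw [show (v₀ * cW + 4 * S'.card * Cμ) * (ε / (2 * D)) = (ε / 2) * ((v₀ * cW + 4 * S'.card * Cμ) / D) by
      field_simp]
    refine mul_le_of_le_one_right (by positivity) ((div_le_one hD0).2 (by rw [hD]; linarith))
  linarith

/-! ## §4 The limit `R → ∞`: the cross term vanishes for every finite-action `C¹` competitor with zero plaquette variables -/

/-- `dθ_R = 0` inside `B_R` (where `θ_R ≡ 1`). [cite: Federbush1986PhaseCellI, §3 p. 327, (3.13) p. 328] -/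
theorem fderiv_cutoff_eq_zero_of_lt (hR : 0 < R) {x : E4} (hx : ‖x‖ < R) : fderiv ℝ (cutoff R) x = 0 := by
  have h : cutoff R =ᶠ[𝓝 x] fun _ => (1 : ℝ) := by
    have ho : IsOpen (ball (0 : E4) R) := isOpen_ball
    filter_upwards [ho.mem_nhds (mem_ball_zero_iff.2 hx)] with y hy
    exact cutoff_eq_one hR (mem_ball_zero_iff.1 hy).le
  rw [h.fderiv_eq, fderiv_const_apply]

/-- `∂_μθ_R = 0` inside `B_R`. [cite: Federbush1986PhaseCellI, §3 p. 327, (3.13) p. 328] -/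
theorem dcut_eq_zero_of_lt (hR : 0 < R) {x : E4} (hx : ‖x‖ < R) (μ : Fin 4) : dcut R μ x = 0 := by
  simp [dcut, fderiv_cutoff_eq_zero_of_lt hR hx]

/-- **Pointwise bound for the shell term**: supported in `R ≤ ‖x‖ ≤ 2R`, where `|F(A^N)| ≤ C_A e^{−γ_A R}`.
[cite: Federbush1986PhaseCellI, (3.14) p. 328] -/
theorem abs_shellTerm_le {s : ℕ} {CA γA B₁ : ℝ} (hCA0 : 0 ≤ CA)
    (hFA : ∀ μ ν x, |fieldStrength (field s) μ ν x| ≤ CA * Real.exp (-(γA * ‖x‖))) (hγA : 0 < γA)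
    (hB : ∀ μ x, |dcut R μ x| ≤ B₁) (hR : 0 < R) (f : E4 → Fin 4 → ℝ) (x : E4) :
    |shellTerm s R f x| ≤ (closedBall (0 : E4) (2 * R)).indicator
      (fun x => 8 * CA * B₁ * Real.exp (-(γA * R)) * ∑ ν, |f x ν|) x := by
  have hB0 : 0 ≤ B₁ := (abs_nonneg _).trans (hB 0 x)
  by_cases hx2 : x ∈ closedBall (0 : E4) (2 * R)
  · rw [indicator_of_mem hx2]
    by_cases hx1 : ‖x‖ < R
    · rw [shellTerm]; simp [dcut_eq_zero_of_lt hR hx1]; positivity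
    · push Not at hx1
      have hexp : ∀ μ ν, |fieldStrength (field s) μ ν x| ≤ CA * Real.exp (-(γA * R)) := fun μ ν =>
        (hFA μ ν x).trans (mul_le_mul_of_nonneg_left (Real.exp_le_exp.2 (by nlinarith)) hCA0)
      unfold shellTerm
      have hterm : ∀ μ ν, |(if μ < ν then fieldStrength (field s) μ ν x * (dcut R μ x * f x ν - dcut R ν x * f x μ) else 0)|
          ≤ CA * Real.exp (-(γA * R)) * (B₁ * (|f x ν| + |f x μ|)) := by
        intro μ ν
        split_ifs
        · rw [abs_mul]
          refine mul_le_mul (hexp μ ν) ?_ (abs_nonneg _) (by positivity)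
          calc |dcut R μ x * f x ν - dcut R ν x * f x μ| ≤ |dcut R μ x * f x ν| + |dcut R ν x * f x μ| := abs_sub _ _
            _ ≤ B₁ * |f x ν| + B₁ * |f x μ| := by
                rw [abs_mul, abs_mul]
                exact add_le_add (mul_le_mul_of_nonneg_right (hB μ x) (abs_nonneg _))
                  (mul_le_mul_of_nonneg_right (hB ν x) (abs_nonneg _))
            _ = B₁ * (|f x ν| + |f x μ|) := by ring
        · rw [abs_zero]; positivity
      calc |∑ μ, ∑ ν, (if μ < ν then fieldStrength (field s) μ ν x * (dcut R μ x * f x ν - dcut R ν x * f x μ) else 0)|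
          ≤ ∑ μ, ∑ ν, CA * Real.exp (-(γA * R)) * (B₁ * (|f x ν| + |f x μ|)) :=
            (Finset.abs_sum_le_sum_abs _ _).trans (Finset.sum_le_sum fun μ _ =>
              (Finset.abs_sum_le_sum_abs _ _).trans (Finset.sum_le_sum fun ν _ => hterm μ ν))
        _ = 8 * CA * B₁ * Real.exp (-(γA * R)) * ∑ ν, |f x ν| := by
            simp only [mul_add, Finset.sum_add_distrib, Finset.sum_const, Finset.card_univ, Fintype.card_fin,
              nsmul_eq_mul, ← Finset.mul_sum]
            push_cast; ring
  · rw [indicator_of_notMem hx2, shellTerm_eq_zero hR s f (le_of_lt (by simpa [dist_zero_right] using hx2)), abs_zero]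

/-- **The shell term integrates to `O(e^{−γ_A R}·‖f‖_{L¹(B_{2R})})`.** [cite: Federbush1986PhaseCellI, (3.14) p. 328] -/
theorem abs_integral_shellTerm_le {s : ℕ} {CA γA B₁ : ℝ} (hCA0 : 0 ≤ CA)
    (hFA : ∀ μ ν x, |fieldStrength (field s) μ ν x| ≤ CA * Real.exp (-(γA * ‖x‖))) (hγA : 0 < γA)
    (hB : ∀ μ x, |dcut R μ x| ≤ B₁) (hR : 0 < R) {f : E4 → Fin 4 → ℝ} (hf : Continuous f) :
    |∫ x, shellTerm s R f x| ≤ 8 * CA * B₁ * Real.exp (-(γA * R)) * ∑ ν, ∫ x in closedBall (0 : E4) (2 * R), |f x ν| := by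
  have hK : IsCompact (closedBall (0 : E4) (2 * R)) := isCompact_closedBall _ _
  have hgc : Continuous fun x => 8 * CA * B₁ * Real.exp (-(γA * R)) * ∑ ν, |f x ν| :=
    continuous_const.mul (continuous_finsetSum _ fun ν _ => ((continuous_apply ν).comp hf).abs)
  have hgi : Integrable ((closedBall (0 : E4) (2 * R)).indicator fun x => 8 * CA * B₁ * Real.exp (-(γA * R)) * ∑ ν, |f x ν|) :=
    (hgc.continuousOn.integrableOn_compact hK).integrable_indicator measurableSet_closedBall
  refine (Real.norm_eq_abs _ ▸ norm_integral_le_of_norm_le hgi (Eventually.of_forall fun x => ?_)).trans (le_of_eq ?_)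
  · rw [Real.norm_eq_abs]; exact abs_shellTerm_le hCA0 hFA hγA hB hR f x
  · rw [integral_indicator measurableSet_closedBall, integral_const_mul]
    congr 1
    exact integral_finsetSum Finset.univ (f := fun ν x => |f x ν|) fun ν _ =>
      ((continuous_apply ν).comp hf).abs.continuousOn.integrableOn_compact hK

/-- `‖n‖ ≤ Σ_k |n_k|` for lattice points (ℓ² ≤ ℓ¹). [cite: Federbush1986PhaseCellI, §3 p. 327, (3.13) p. 328] -/
theorem norm_latVec_le_sum (m : Fin 4 → ℤ) : ‖latVec m‖ ≤ ∑ k, |(m k : ℝ)| := by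
  have h : latVec m = ∑ k, ((m k : ℝ)) • unitVec k := by
    ext j; simp [latVec, mkPt, unitVec, Finset.sum_apply, Pi.single_apply]
  rw [h]
  refine (norm_sum_le _ _).trans (Finset.sum_le_sum fun k _ => ?_)
  rw [norm_smul, Real.norm_eq_abs]
  have : ‖(unitVec k : E4)‖ = 1 := by simp [unitVec]
  rw [this, mul_one]

/-- `|n_k| ≤ ‖n‖`. [cite: Federbush1986PhaseCellI, §3 p. 327, (3.13) p. 328] -/
theorem abs_apply_le_norm_latVec (m : Fin 4 → ℤ) (k : Fin 4) : |(m k : ℝ)| ≤ ‖latVec m‖ := by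
  have := PiLp.norm_apply_le (latVec m) k
  rwa [latVec_apply, Real.norm_eq_abs] at this

/-- The cardinality of the lattice box. [cite: Federbush1986PhaseCellI, §3 p. 327, (3.13) p. 328] -/
theorem card_boxSet (N : ℕ) : (boxSet N).card = (2 * N + 1) ^ 4 := by
  rw [boxSet, Fintype.card_piFinset, Finset.prod_const, Finset.card_univ, Fintype.card_fin, Int.card_Icc]
  congr 1
  omega

/-- **Bound for the right-hand side**: inner bonds (`‖m‖ + 4 ≤ R`) have zero cut-off bond variable when `f` has zero bond
variables there; the others carry the exponentially small multipliers against `‖f‖_{L¹}`.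
[cite: Federbush1986PhaseCellI, §3 p. 327, (3.11)/(3.13) p. 328] -/
theorem abs_rhsSum_le {Cμ γμ : ℝ} (hCμ0 : 0 ≤ Cμ) (hγμ : 0 < γμ)
    (hμ : ∀ ν m, |bondMult ν m| ≤ Cμ * Real.exp (-(γμ * ∑ k, |((m k : ℤ) : ℝ)|)))
    (hR : 0 < R) {f : E4 → Fin 4 → ℝ} (hf : Continuous f)
    (hzero : ∀ (m : Fin 4 → ℤ) (ν : Fin 4), ‖latVec m‖ + 4 ≤ R → approxTop 0 f ⟨m, ν⟩ = 0)
    (N : ℕ) {Q : ℝ} (hQ : ∀ ν, ∫ x in closedBall (0 : E4) (2 * ((N : ℝ) + 2)), |f x ν| ≤ Q) :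
    |rhsSum R f (boxSet N)| ≤ 4 * (boxSet N).card * Cμ * Real.exp (-(γμ * (R - 4))) * Q := by
  have hQ0 : 0 ≤ Q := (setIntegral_nonneg measurableSet_closedBall fun x _ => abs_nonneg _).trans (hQ 0)
  unfold rhsSum
  have hterm : ∀ ν, ∀ m ∈ boxSet N, |bondMult ν m * approxTop 0 (cut R f) ⟨m, ν⟩| ≤ Cμ * Real.exp (-(γμ * (R - 4))) * Q := by
    intro ν m hm
    have hm' := mem_boxSet.1 hm
    by_cases hin : ‖latVec m‖ + 4 ≤ R
    · -- inner bond: the cut-off is `1` on the box and `f` has zero bond variable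
      rw [approxTop_cut_eq_of_near hR f fun u hu => ?_, hzero m ν hin, mul_zero, abs_zero]
      · positivity
      · calc ‖(((⟨m, ν⟩ : Edge 0).src) + mkPt u : E4)‖ ≤ ‖((⟨m, ν⟩ : Edge 0).src : E4)‖ + ‖(mkPt u : E4)‖ := norm_add_le _ _
          _ ≤ ‖latVec m‖ + 4 := by rw [src_eq_latVec]; exact add_le_add le_rfl (norm_mkPt_le_four hu)
          _ ≤ R := hin
    · push Not at hin
      rw [abs_mul]
      have h1 : |bondMult ν m| ≤ Cμ * Real.exp (-(γμ * (R - 4))) := by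
        refine (hμ ν m).trans (mul_le_mul_of_nonneg_left (Real.exp_le_exp.2 ?_) hCμ0)
        have := norm_latVec_le_sum m
        nlinarith
      have h2 : |approxTop 0 (cut R f) ⟨m, ν⟩| ≤ Q := by
        refine (abs_approxTop_cut_le_setIntegral hf m ν fun u hu => ?_).trans (hQ ν)
        exact norm_src_add_mkPt_le (B := (N : ℝ)) (fun k => by
          rw [← Int.cast_abs]; exact_mod_cast abs_le.2 ⟨(hm' k).1, (hm' k).2⟩) hu
      exact mul_le_mul h1 h2 (abs_nonneg _) (by positivity)
  calc |∑ ν, ∑ m ∈ boxSet N, bondMult ν m * approxTop 0 (cut R f) ⟨m, ν⟩|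
      ≤ ∑ ν, ∑ m ∈ boxSet N, Cμ * Real.exp (-(γμ * (R - 4))) * Q :=
        (Finset.abs_sum_le_sum_abs _ _).trans (Finset.sum_le_sum fun ν _ =>
          (Finset.abs_sum_le_sum_abs _ _).trans (Finset.sum_le_sum fun m hm => hterm ν m hm))
    _ = 4 * (boxSet N).card * Cμ * Real.exp (-(γμ * (R - 4))) * Q := by
        simp only [Finset.sum_const, Finset.card_univ, Fintype.card_fin, nsmul_eq_mul]; push_cast; ring

/-- Polynomial times decaying exponential tends to zero along `ℕ`. [cite: Federbush1986PhaseCellI, §3 p. 327, (3.13) p. 328] -/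
theorem tendsto_pow_mul_exp_neg {γ : ℝ} (hγ : 0 < γ) (k : ℕ) (a : ℝ) :
    Tendsto (fun n : ℕ => ((n : ℝ) + a) ^ k * Real.exp (-(γ * ((n : ℝ) + a)))) atTop (𝓝 0) := by
  have h1 : Tendsto (fun x : ℝ => x ^ k * Real.exp (-(γ * x))) atTop (𝓝 0) := by
    have h := ((Real.tendsto_pow_mul_exp_neg_atTop_nhds_zero k).comp (tendsto_id.const_mul_atTop hγ)).const_mul ((γ ^ k)⁻¹)
    rw [mul_zero] at h
    refine h.congr fun x => ?_
    simp only [Function.comp_apply, id_eq, mul_pow]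
    field_simp
  have h2 : Tendsto (fun n : ℕ => (n : ℝ) + a) atTop atTop :=
    tendsto_atTop_add_const_right _ a tendsto_natCast_atTop_atTop
  exact h1.comp h2

/-- **THE CROSS TERM VANISHES FOR EVERY FINITE-ACTION `C¹` COMPETITOR WITH ZERO PLAQUETTE VARIABLES**:
`∫ Σ_{μ<ν} F_{μν}(A^N) F_{μν}(ψ) = 0` whenever `ψ ∈ C¹`, `∫|F(ψ)|² < ∞` and `ψ(∂q) = 0` for every level-0 plaquette `q` —
the weak Euler–Lagrange equation of the constrained minimality (3.4)/(3.11), extended from compactly supported smooth test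
fields (`LandauModeWeakEulerLagrange`, `LandauModeBondMultipliers`) by gauge fixing (radial gauge + lattice axial gauge),
mollification, cut-off, and the exponential decay of the mode ((3.13)–(3.14)) and of the multipliers.
[cite: Federbush1986PhaseCellI, §3 p. 327 («We also require A_μ(x) to minimize the continuum action, subject to the constraint» …
«(Alternatively one could use Lagrange multipliers.)»), (3.4) p. 327, (3.11), (3.13)–(3.14) p. 328] -/
theorem integral_crossDensity_field_eq_zero_of_plaq_eq_zero (s : ℕ) (hψ : ContDiff ℝ 1 ψ) (hfin : contAction ψ ≠ ⊤)
    (hplaq : ∀ q : Plaq 0, plaqFunctional 0 ψ q = 0) : ∫ x, crossDensity (field s) ψ x = 0 := by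
  -- constants
  obtain ⟨CA, γA, hCA0, hγA, hFA⟩ := exists_fieldStrength_field_bound s
  obtain ⟨B₁, hB₁0, hB₁⟩ := exists_fderiv_theta1_bound
  obtain ⟨Cμ, γμ, hCμ0, hγμ, hμ⟩ := exists_bondMult_le_exp_sum_all
  obtain ⟨Cg, hCg0, hCg⟩ := exists_psiHat_growth hψ hfin
  have hcross_int : Integrable (crossDensity (field s) ψ) :=
    integrable_crossDensity (contDiff_field s) hψ (contAction_field_ne_top s) hfin
  -- the sequence `T n = ∫ θ_{n+1} · cross`
  set T : ℕ → ℝ := fun n => ∫ x, cutoff ((n : ℝ) + 1) x * crossDensity (field s) ψ x with hT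
  -- (A) `T n → ∫ cross` (dominated convergence)
  have hA : Tendsto T atTop (𝓝 (∫ x, crossDensity (field s) ψ x)) := by
    refine tendsto_integral_of_dominated_convergence (fun x => |crossDensity (field s) ψ x|)
      (fun n => ((contDiff_cutoff ((n : ℝ) + 1) (n := 0)).continuous.mul
        (continuous_crossDensity (contDiff_field s) hψ)).aestronglyMeasurable) hcross_int.abs
      (fun n => Eventually.of_forall fun x => ?_) (Eventually.of_forall fun x => ?_)
    · rw [Real.norm_eq_abs, abs_mul]
      exact mul_le_of_le_one_left (abs_nonneg _) (abs_cutoff_le_one _ x)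
    · refine tendsto_atTop_of_eventually_const (i₀ := ⌈‖x‖⌉₊) fun n hn => ?_
      rw [cutoff_eq_one (by positivity) ?_, one_mul]
      have : (⌈‖x‖⌉₊ : ℝ) ≤ n := by exact_mod_cast hn
      linarith [Nat.le_ceil ‖x‖]
  -- (B) `|T n| ≤ E n` with `E n → 0`
  set E : ℕ → ℝ := fun n =>
    (4 * (4 * (n : ℝ) + 9) ^ 4 * Cμ * Real.exp (-(γμ * ((n : ℝ) + 1 - 4))) + 8 * CA * B₁ * Real.exp (-(γA * ((n : ℝ) + 1))) * 4)
      * (Cg * (((n + 1 : ℕ) : ℝ) + 10) ^ 10) with hE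
  have hB : ∀ n : ℕ, |T n| ≤ E n := by
    intro n
    set ρ : ℝ := (n : ℝ) + 1 with hρ
    have hρ1 : 1 ≤ ρ := by rw [hρ]; have := n.cast_nonneg (α := ℝ); linarith
    have hρ0 : 0 < ρ := one_pos.trans_le hρ1
    set L : ℕ := 2 * (n + 1) + 6 with hL
    set N : ℕ := 2 * (n + 1) + 2 with hN
    set Ψ := psiHat ψ L with hΨ
    have hΨc : Continuous Ψ := continuous_psiHat hψ L
    -- the identity at level `(ρ, L)`
    have hS' : ∀ m ∉ boxSet N, ∃ k, 2 * ρ + 2 < |((m k : ℤ) : ℝ)| := by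
      intro m hm
      rw [mem_boxSet] at hm; push Not at hm
      obtain ⟨k, hk⟩ := hm
      refine ⟨k, ?_⟩
      have hNρ : (N : ℝ) = 2 * ρ + 2 := by rw [hN, hρ]; push_cast; ring
      rw [← hNρ]
      have : (N : ℤ) + 1 ≤ |m k| := by
        rcases le_or_gt (-(N : ℤ)) (m k) with h | h
        · have := hk h; rw [abs_of_nonneg (by omega)]; omega
        · rw [abs_of_neg (by omega)]; omega
      have h' : ((N : ℤ) : ℝ) + 1 ≤ ((|m k| : ℤ) : ℝ) := by exact_mod_cast this
      push_cast at h'; linarith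
    have hid := integral_cut_eq_rhsSum s hψ hfin hρ1 L (boxSet N) hS'
    rw [integral_add (integrable_cutoff_mul_crossDensity s hψ hfin ρ) (integrable_shellTerm hρ0 s hΨc)] at hid
    have hTn : T n = rhsSum ρ Ψ (boxSet N) - ∫ x, shellTerm s ρ Ψ x := by rw [hT]; simp only; linarith
    -- the `L¹` size of `Ψ` on `B_{4ρ+10}`
    set Q : ℝ := Cg * (((n + 1 : ℕ) : ℝ) + 10) ^ 10 with hQdef
    have hQ : ∀ ν, ∫ x in closedBall (0 : E4) (4 * ρ + 10), |Ψ x ν| ≤ Q := fun ν => by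
      have := hCg (n + 1) ν
      have e : (4 * ρ + 10 : ℝ) = 4 * ((n + 1 : ℕ) : ℝ) + 10 := by rw [hρ]; push_cast; ring
      rw [e, hΨ, hL, hQdef]; exact this
    have hQ0 : 0 ≤ Q := by positivity
    have hmono : ∀ ν (r : ℝ), r ≤ 4 * ρ + 10 → ∫ x in closedBall (0 : E4) r, |Ψ x ν| ≤ Q := fun ν r hr =>
      (setIntegral_mono_set ((((continuous_apply ν).comp hΨc).abs).continuousOn.integrableOn_compact (isCompact_closedBall _ _))
        (Eventually.of_forall fun x => abs_nonneg _) (Eventually.of_forall (closedBall_subset_closedBall hr))).trans (hQ ν)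
    -- the shell integral
    have hdc : ∀ μ x, |dcut ρ μ x| ≤ B₁ := fun μ x => abs_dcut_le hB₁ hρ1 μ x
    have hsh : |∫ x, shellTerm s ρ Ψ x| ≤ 8 * CA * B₁ * Real.exp (-(γA * ρ)) * (4 * Q) := by
      refine (abs_integral_shellTerm_le hCA0 hFA hγA hdc hρ0 hΨc).trans (mul_le_mul_of_nonneg_left ?_ (by positivity))
      calc ∑ ν, ∫ x in closedBall (0 : E4) (2 * ρ), |Ψ x ν| ≤ ∑ _ν : Fin 4, Q :=
            Finset.sum_le_sum fun ν _ => hmono ν _ (by linarith)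
        _ = 4 * Q := by simp
    -- the right-hand side
    have hzero : ∀ (m : Fin 4 → ℤ) (ν : Fin 4), ‖latVec m‖ + 4 ≤ ρ → approxTop 0 Ψ ⟨m, ν⟩ = 0 := by
      intro m ν hm
      have hmk : ∀ k, |((m k : ℤ) : ℝ)| ≤ ρ - 4 := fun k => (abs_apply_le_norm_latVec m k).trans (by linarith)
      have hLρ : ((L : ℕ) : ℝ) = 2 * ρ + 6 := by rw [hL, hρ]; push_cast; ring
      have hmk' : ∀ k, -(L : ℤ) ≤ m k ∧ m k ≤ (L : ℤ) - 1 := by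
        intro k
        have h := abs_le.1 (hmk k)
        constructor
        · have : (-(L : ℤ) : ℝ) ≤ ((m k : ℤ) : ℝ) := by push_cast; linarith
          exact_mod_cast this
        · have : ((m k : ℤ) : ℝ) ≤ ((L : ℤ) : ℝ) - 1 := by push_cast; linarith
          exact_mod_cast this
      exact approxTop_psiHat_eq_zero hψ hplaq (fun j => (hmk' j).1) (fun j => by linarith [(hmk' j).2]) (by linarith [(hmk' ν).2])
    have hrhs : |rhsSum ρ Ψ (boxSet N)| ≤ 4 * (boxSet N).card * Cμ * Real.exp (-(γμ * (ρ - 4))) * Q :=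
      abs_rhsSum_le hCμ0 hγμ hμ hρ0 hΨc hzero N fun ν => hmono ν _ (by rw [hN, hρ]; push_cast; linarith)
    have hcard : ((boxSet N).card : ℝ) = (4 * (n : ℝ) + 9) ^ 4 := by
      rw [card_boxSet, hN]; push_cast; ring
    -- assemble
    rw [hTn]
    calc |rhsSum ρ Ψ (boxSet N) - ∫ x, shellTerm s ρ Ψ x|
        ≤ |rhsSum ρ Ψ (boxSet N)| + |∫ x, shellTerm s ρ Ψ x| := abs_sub _ _
      _ ≤ 4 * (boxSet N).card * Cμ * Real.exp (-(γμ * (ρ - 4))) * Q + 8 * CA * B₁ * Real.exp (-(γA * ρ)) * (4 * Q) :=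
          add_le_add hrhs hsh
      _ = E n := by rw [hE, hcard]; simp only [hρ, hQdef]; ring
  -- (C) `E n → 0`
  have hE0 : Tendsto E atTop (𝓝 0) := by
    -- `E n = (a₁ (4n+13)^4 e^{-γμ(n-3)} + a₂ e^{-γA(n+1)}) · Cg (n+11)^10`
    have e1 : Tendsto (fun n : ℕ => ((n : ℝ) + 11) ^ 14 * Real.exp (-(γμ * ((n : ℝ) + 11)))) atTop (𝓝 0) :=
      tendsto_pow_mul_exp_neg hγμ 14 11
    have e2 : Tendsto (fun n : ℕ => ((n : ℝ) + 11) ^ 10 * Real.exp (-(γA * ((n : ℝ) + 11)))) atTop (𝓝 0) :=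
      tendsto_pow_mul_exp_neg hγA 10 11
    -- domination `|E n| ≤ c₁·e1 n + c₂·e2 n`
    set c₁ : ℝ := 4 * 4 ^ 4 * Cμ * Real.exp (γμ * 14) * Cg with hc₁
    set c₂ : ℝ := 32 * CA * B₁ * Real.exp (γA * 10) * Cg with hc₂
    have hlim := (e1.const_mul c₁).add (e2.const_mul c₂)
    rw [mul_zero, mul_zero, add_zero] at hlim
    have hEpos : ∀ n, 0 ≤ E n := fun n => by simp only [hE]; positivity
    refine squeeze_zero_norm (fun n => ?_) hlim
    have hn0 : (0 : ℝ) ≤ n := n.cast_nonneg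
    have hX1 : (1 : ℝ) ≤ (n : ℝ) + 11 := by linarith
    rw [Real.norm_eq_abs, abs_of_nonneg (hEpos n)]
    simp only [hE]
    have hq : (((n + 1 : ℕ) : ℝ) + 10) = (n : ℝ) + 11 := by push_cast; ring
    rw [hq]
    have hexp1 : Real.exp (-(γμ * ((n : ℝ) + 1 - 4))) = Real.exp (γμ * 14) * Real.exp (-(γμ * ((n : ℝ) + 11))) := by
      rw [← Real.exp_add]; ring_nf
    have hexp2 : Real.exp (-(γA * ((n : ℝ) + 1))) = Real.exp (γA * 10) * Real.exp (-(γA * ((n : ℝ) + 11))) := by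
      rw [← Real.exp_add]; ring_nf
    have hpoly : (4 * (n : ℝ) + 9) ^ 4 ≤ 4 ^ 4 * ((n : ℝ) + 11) ^ 4 := by
      rw [← mul_pow]; exact pow_le_pow_left₀ (by positivity) (by linarith) 4
    rw [hexp1, hexp2]
    have h14 : ((n : ℝ) + 11) ^ 4 * ((n : ℝ) + 11) ^ 10 = ((n : ℝ) + 11) ^ 14 := by ring
    calc (4 * (4 * (n : ℝ) + 9) ^ 4 * Cμ * (Real.exp (γμ * 14) * Real.exp (-(γμ * ((n : ℝ) + 11)))) +
          8 * CA * B₁ * (Real.exp (γA * 10) * Real.exp (-(γA * ((n : ℝ) + 11)))) * 4) * (Cg * ((n : ℝ) + 11) ^ 10)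
        ≤ (4 * (4 ^ 4 * ((n : ℝ) + 11) ^ 4) * Cμ * (Real.exp (γμ * 14) * Real.exp (-(γμ * ((n : ℝ) + 11)))) +
          8 * CA * B₁ * (Real.exp (γA * 10) * Real.exp (-(γA * ((n : ℝ) + 11)))) * 4) * (Cg * ((n : ℝ) + 11) ^ 10) := by
          gcongr
      _ = c₁ * (((n : ℝ) + 11) ^ 14 * Real.exp (-(γμ * ((n : ℝ) + 11))))
          + c₂ * (((n : ℝ) + 11) ^ 10 * Real.exp (-(γA * ((n : ℝ) + 11)))) := by
          rw [hc₁, hc₂, ← h14]; ring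
  -- (D) conclude by uniqueness of limits
  have hB' : Tendsto T atTop (𝓝 0) := squeeze_zero_norm (fun n => by rw [Real.norm_eq_abs]; exact hB n) hE0
  exact tendsto_nhds_unique hA hB'

/-! ## §5 The constrained minimality of `A^N` and the statement of I §0 -/

/-- Plaquette variables are additive in the field (continuous fields). [cite: Federbush1986PhaseCellI, (1.12)–(1.14) p. 324] -/
theorem plaqFunctional_sub {A B : E4 → Fin 4 → ℝ} (hA : Continuous A) (hB : Continuous B) (q : Plaq 0) :
    plaqFunctional 0 (fun x ν => A x ν - B x ν) q = plaqFunctional 0 A q - plaqFunctional 0 B q := by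
  have hAB : Continuous fun x ν => A x ν - B x ν := continuous_pi fun ν =>
    ((continuous_apply ν).comp hA).sub ((continuous_apply ν).comp hB)
  rw [← plaqOfBonds_approxTop _ hAB, ← plaqOfBonds_approxTop _ hA, ← plaqOfBonds_approxTop _ hB]
  have h : ∀ e : Edge 0, approxTop 0 (fun x ν => A x ν - B x ν) e = approxTop 0 A e - approxTop 0 B e := by
    intro e
    have h1 : (fun x ν => A x ν - B x ν) = fun x ν => A x ν + ((-1 : ℝ) • B) x ν := by
      funext x ν; simp; ring
    rw [h1, approxTop_add hA (hB.const_smul _), ModeLinearity.approxTop_smul]; ring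
  obtain ⟨b, i, j⟩ := q
  simp only [plaqOfBonds, h]
  ring

/-- **THE CONSTRAINED MINIMALITY OF THE LANDAU-GAUGE MODE (3.4)/§3**: every `C¹` potential with the level-0 plaquette variables
of `A^N = field s` has at least its continuum action.  (Infinite-action competitors trivially; for finite action, with
`ψ = A′ − A^N`: `S(A′) = S(A^N) + 2∫Σ F(A^N)F(ψ) + S(ψ)` and the cross term vanishes.)
[cite: Federbush1986PhaseCellI, §3 p. 327 («In this section (and Part II of this paper) we construct a potential, A^N_μ(x), satisfying
Estimates 0.1–0.3, yielding the correct plaquette assignments at level 0, and minimizing the continuum action subject to this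
constraint.» / «We seek a minimum of the action S, for a Landau gauge A′»), (3.4) p. 327, §4 p. 329] -/
theorem field_minimal (s : ℕ) (A' : E4 → Fin 4 → ℝ) (hA' : ContDiff ℝ 1 A')
    (hpl : ∀ p : Plaq 0, axialTreeAveraging.plaq 0 A' p = axialTreeAveraging.plaq 0 (field s) p) :
    contAction (field s) ≤ contAction A' := by
  by_cases hfin' : contAction A' = ⊤
  · rw [hfin']; exact le_top
  have hA := contDiff_field s
  have hAf := contAction_field_ne_top s
  set ψ : E4 → Fin 4 → ℝ := A' - field s with hψdef
  have hψ : ContDiff ℝ 1 ψ := hA'.sub hA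
  have hψf : contAction ψ ≠ ⊤ := contAction_sub_ne_top hA' hA hfin' hAf
  have hplaq : ∀ q : Plaq 0, plaqFunctional 0 ψ q = 0 := by
    intro q
    have h := hpl q
    rw [axialTreeAveraging_plaq_eq_plaqFunctional hA' 0 q, axialTreeAveraging_plaq_eq_plaqFunctional hA 0 q] at h
    have : ψ = fun x ν => A' x ν - field s x ν := by funext x ν; rfl
    rw [this, plaqFunctional_sub hA'.continuous hA.continuous, h, sub_self]
  have hcross := integral_crossDensity_field_eq_zero_of_plaq_eq_zero s hψ hψf hplaq
  have hsum : A' = field s + ψ := by rw [hψdef]; abel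
  have hreal := toReal_contAction_add hA hψ hAf hψf
  rw [← hsum, hcross, mul_zero, add_zero] at hreal
  have h0 : 0 ≤ (contAction ψ).toReal := ENNReal.toReal_nonneg
  exact (ENNReal.toReal_le_toReal hAf hfin').1 (by linarith)

/-- **THE STATEMENT OF [Federbush1986PhaseCellI] §0 (Estimates 0.1–0.7, `≤` reading) HOLDS UNCONDITIONALLY for the concrete
Bałaban averaging `axialTreeAveraging`**: the one remaining hypothesis `hmin` of `modeEstimatesLe_of_field_minimal` — the
constrained minimality of the explicit Landau-gauge mode — is `field_minimal`. [cite: Federbush1986PhaseCellI, §0 pp. 320–321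
(«We will find an A_μ(x) compatible with this assignment, minimizing the continuum action, and "smooth" enough, so that the
following results hold»), §3 p. 327, §4 pp. 328–329] -/
theorem modeEstimatesLe : axialTreeAveraging.ModeEstimatesLe :=
  modeEstimatesLe_of_field_minimal 0 (field_minimal 0)

end CorrectedMode

end

end Literature.MathematicalPhysics.QuantumFieldTheory.Federbush1986
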